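import Mathlib.Analysis.SpecialFunctions.SmoothTransition
import Mathlib.Analysis.SpecialFunctions.Log.Deriv
import Mathlib.Analysis.Calculus.MeanValue

/-!
# Helper `helper_friendsCarrier_Vk_partB_logCutoff` (piece of the registered stub
`helper_friendsCarrier_Vk_partB`, line `mk_friends`, skeleton v8) for crux `DcrGap`
(item stmt-SmoothPoincare4-16128, route route-SmoothPoincare4-DottedCircleRasmussen)

**The logarithmic cutoff.**  Part B of V_k reparametrises the rays of the model slice disc near its
boundary circle: the radius `t` is replaced by `t^{1-β(t)} ρ_u(t)^{β(t)}`, where `ρ_u` is the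
level-parametrised radius (`G_k(f₁(ρ_u(t) u)) = 2 - t`) and `β` a cutoff equal to `1` near `t = 1` and
to `0` away from it.  For the new radius to be monotone along every ray the cutoff must vary SLOWLY
in the variable `log (1 - t)`: the derivative of the blend contains the term `β'(t) log(ρ_u(t)/t)`,
and `|log(ρ_u(t)/t)| ≤ A (1 - t)`, so one needs `|β'(t)| (1 - t)` small — a plain cutoff on an
interval `[1 - 2τ, 1 - τ]` only gives `|β'(t)| (1 - t) ≈ 2`.  This file builds, for every
`τ₀ ∈ (0, 1)` and `κ > 0`, a `C^∞` cutoff `β : ℝ → ℝ` with values in `[0, 1]`, `β = 0` on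
`t ≤ 1 - τ₀`, `β = 1` on `t ≥ 1 - τ₁` (`0 < τ₁ < τ₀`), and `|β'(t)| (1 - t) ≤ κ` for all `t < 1`:
`β(t) = 1 - φ(log((1 - t)/τ₁)/L)` with Mathlib's `Real.smoothTransition` `φ`, `L = C/κ + 1` for a bound
`C` of `φ'`, and `τ₁ = τ₀ e^{-L}`.

No definitions, no named facts, no `sorry`.
-/

-- the prescribed namespace `Summit.<P>.<Sub>.…` duplicates `SmoothPoincare4` (P = Sub)
set_option linter.dupNamespace false
set_option linter.style.longLine false

noncomputable section

open scoped ContDiff Topology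
open Set Filter

namespace Summit.SmoothPoincare4.SmoothPoincare4.Theorems.DcrGap.MkFriends

namespace FriendsCarrierVk

/-- The derivative of `Real.smoothTransition` is bounded. [folklore] -/
theorem exists_bound_deriv_smoothTransition : ∃ C : ℝ, 0 ≤ C ∧ ∀ z : ℝ, |deriv Real.smoothTransition z| ≤ C := by
  have hc : Continuous (deriv Real.smoothTransition) :=
    (Real.smoothTransition.contDiff (n := 1)).continuous_deriv le_rfl
  obtain ⟨C, hC⟩ := (isCompact_Icc (a := (0 : ℝ)) (b := 1)).exists_bound_of_continuousOn hc.continuousOn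
  have hC0 : 0 ≤ C := le_trans (norm_nonneg _) (hC 0 ⟨le_rfl, zero_le_one⟩)
  refine ⟨C, hC0, fun z => ?_⟩
  by_cases hz : z ∈ Icc (0 : ℝ) 1
  · have := hC z hz
    rwa [Real.norm_eq_abs] at this
  · -- outside `[0, 1]` the transition is locally constant
    have hderiv : deriv Real.smoothTransition z = 0 := by
      rcases lt_or_ge z 0 with h0 | h0
      · have hev : Real.smoothTransition =ᶠ[𝓝 z] fun _ => (0 : ℝ) := by
          filter_upwards [Iio_mem_nhds h0] with y hy
          exact Real.smoothTransition.zero_of_nonpos (le_of_lt hy)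
        rw [hev.deriv_eq, deriv_const]
      · have h1 : 1 < z := lt_of_not_ge fun h => hz ⟨h0, h⟩
        have hev : Real.smoothTransition =ᶠ[𝓝 z] fun _ => (1 : ℝ) := by
          filter_upwards [Ioi_mem_nhds h1] with y hy
          exact Real.smoothTransition.one_of_one_le (le_of_lt hy)
        rw [hev.deriv_eq, deriv_const]
    rw [hderiv, abs_zero]
    exact hC0

/-- **The logarithmic cutoff.**  For `τ₀ > 0` and `κ > 0` there are `τ₁ ∈ (0, τ₀)` and a `C^∞`
function `β : ℝ → ℝ` with values in `[0, 1]`, vanishing on `t ≤ 1 - τ₀`, equal to `1` on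
`t ≥ 1 - τ₁`, and with `|β'(t)| (1 - t) ≤ κ` for every `t < 1`. [folklore] -/
theorem exists_logCutoff {τ₀ κ : ℝ} (hτ₀ : 0 < τ₀) (hκ : 0 < κ) :
    ∃ (β : ℝ → ℝ) (τ₁ : ℝ), 0 < τ₁ ∧ τ₁ < τ₀ ∧ ContDiff ℝ ∞ β ∧ (∀ t, 0 ≤ β t ∧ β t ≤ 1) ∧
      (∀ t, t ≤ 1 - τ₀ → β t = 0) ∧ (∀ t, 1 - τ₁ ≤ t → β t = 1) ∧
      (∀ t, t < 1 → |deriv β t| * (1 - t) ≤ κ) := by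
  obtain ⟨C, hC0, hC⟩ := exists_bound_deriv_smoothTransition
  set L : ℝ := C / κ + 1 with hL
  have hLpos : 0 < L := by rw [hL]; positivity
  have hCL : C / L ≤ κ := by
    rw [div_le_iff₀ hLpos, hL]
    have : κ * (C / κ + 1) = C + κ := by field_simp
    rw [this]; linarith
  set τ₁ : ℝ := τ₀ * Real.exp (-L) with hτ₁
  have hτ₁pos : 0 < τ₁ := mul_pos hτ₀ (Real.exp_pos _)
  have hexp1 : Real.exp (-L) < 1 := Real.exp_lt_one_iff.mpr (by linarith)
  have hτ₁τ₀ : τ₁ < τ₀ := by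
    rw [hτ₁]; nlinarith
  -- the smooth formula and the cutoff
  set φ : ℝ → ℝ := fun t => 1 - Real.smoothTransition (Real.log ((1 - t) / τ₁) / L) with hφ
  classical
  set β : ℝ → ℝ := fun t => if t < 1 - τ₁ / 2 then φ t else 1 with hβ
  have hβφ : ∀ t, t < 1 - τ₁ / 2 → β t = φ t := fun t ht => by simp only [hβ, if_pos ht]
  -- `φ = 1` on `[1 - τ₁, 1)`
  have hφone : ∀ t, 1 - τ₁ ≤ t → t < 1 → φ t = 1 := by
    intro t ht ht1
    have h1 : (1 - t) / τ₁ ≤ 1 := by rw [div_le_one hτ₁pos]; linarith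
    have h2 : 0 < (1 - t) / τ₁ := div_pos (by linarith) hτ₁pos
    have hlog : Real.log ((1 - t) / τ₁) ≤ 0 := Real.log_nonpos h2.le h1
    have : Real.smoothTransition (Real.log ((1 - t) / τ₁) / L) = 0 :=
      Real.smoothTransition.zero_of_nonpos (div_nonpos_of_nonpos_of_nonneg hlog hLpos.le)
    simp only [hφ, this, sub_zero]
  have hβone : ∀ t, 1 - τ₁ ≤ t → β t = 1 := by
    intro t ht
    by_cases h : t < 1 - τ₁ / 2
    · rw [hβφ t h]; exact hφone t ht (by linarith)
    · simp only [hβ, if_neg h]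
  -- `β = 0` below `1 - τ₀`
  have hβzero : ∀ t, t ≤ 1 - τ₀ → β t = 0 := by
    intro t ht
    have hlt : t < 1 - τ₁ / 2 := by linarith
    rw [hβφ t hlt]
    have hge : Real.exp L ≤ (1 - t) / τ₁ := by
      rw [le_div_iff₀ hτ₁pos, hτ₁, mul_comm, mul_assoc, ← Real.exp_add, neg_add_cancel, Real.exp_zero, mul_one]
      linarith
    have hlog : L ≤ Real.log ((1 - t) / τ₁) := by
      have := Real.log_le_log (Real.exp_pos L) hge
      rwa [Real.log_exp] at this
    have h1 : 1 ≤ Real.log ((1 - t) / τ₁) / L := by rwa [le_div_iff₀ hLpos, one_mul]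
    simp only [hφ, Real.smoothTransition.one_of_one_le h1, sub_self]
  -- smoothness of the formula on `t < 1`
  have hφs : ∀ t, t < 1 → ContDiffAt ℝ ∞ φ t := by
    intro t ht
    have h1 : ContDiffAt ℝ ∞ (fun t : ℝ => (1 - t) / τ₁) t := (contDiffAt_const.sub contDiffAt_id).div_const _
    have h2 : ContDiffAt ℝ ∞ (fun t : ℝ => Real.log ((1 - t) / τ₁)) t := h1.log (div_pos (by linarith) hτ₁pos).ne'
    exact contDiffAt_const.sub (Real.smoothTransition.contDiff.contDiffAt.comp t (h2.div_const L))
  have hβs : ContDiff ℝ ∞ β := by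
    rw [contDiff_iff_contDiffAt]
    intro t
    by_cases ht : t < 1 - τ₁ / 2
    · have hev : β =ᶠ[𝓝 t] φ := by
        filter_upwards [Iio_mem_nhds ht] with y hy
        exact hβφ y hy
      exact (hφs t (by linarith)).congr_of_eventuallyEq hev
    · have hev : β =ᶠ[𝓝 t] fun _ => (1 : ℝ) := by
        filter_upwards [Ioi_mem_nhds (show 1 - τ₁ < t by linarith)] with y hy
        exact hβone y hy.le
      exact contDiffAt_const.congr_of_eventuallyEq hev
  -- the derivative of the formula
  have hφd : ∀ t, t < 1 → HasDerivAt φ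
      (-(deriv Real.smoothTransition (Real.log ((1 - t) / τ₁) / L) * (-(1 - t)⁻¹ / L))) t := by
    intro t ht
    have h1t : 0 < 1 - t := by linarith
    have h1 : HasDerivAt (fun t : ℝ => (1 - t) / τ₁) (-1 / τ₁) t := by
      simpa using ((hasDerivAt_id t).const_sub 1).div_const τ₁
    have h2 : HasDerivAt (fun t : ℝ => Real.log ((1 - t) / τ₁)) (-(1 - t)⁻¹) t := by
      have h := h1.log (div_pos h1t hτ₁pos).ne'
      convert h using 1
      field_simp
    have h3 : HasDerivAt (fun t : ℝ => Real.log ((1 - t) / τ₁) / L) (-(1 - t)⁻¹ / L) t := h2.div_const L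
    have h4 : HasDerivAt Real.smoothTransition (deriv Real.smoothTransition (Real.log ((1 - t) / τ₁) / L))
        (Real.log ((1 - t) / τ₁) / L) :=
      ((Real.smoothTransition.contDiff (n := 1)).differentiable (by simp) _).hasDerivAt
    have h5 := h4.comp t h3
    exact h5.const_sub 1
  have hβd : ∀ t, t < 1 → |deriv β t| * (1 - t) ≤ κ := by
    intro t ht
    have h1t : 0 < 1 - t := by linarith
    by_cases h : 1 - τ₁ < t
    · -- locally constant
      have hev : β =ᶠ[𝓝 t] fun _ => (1 : ℝ) := by
        filter_upwards [Ioi_mem_nhds h] with y hy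
        exact hβone y hy.le
      rw [hev.deriv_eq, deriv_const, abs_zero, zero_mul]
      exact hκ.le
    · push Not at h
      have hlt : t < 1 - τ₁ / 2 := by linarith
      have hev : β =ᶠ[𝓝 t] φ := by
        filter_upwards [Iio_mem_nhds hlt] with y hy
        exact hβφ y hy
      rw [hev.deriv_eq, (hφd t ht).deriv]
      have hz := hC (Real.log ((1 - t) / τ₁) / L)
      have hrew : |-(deriv Real.smoothTransition (Real.log ((1 - t) / τ₁) / L) * (-(1 - t)⁻¹ / L))| * (1 - t) =
          |deriv Real.smoothTransition (Real.log ((1 - t) / τ₁) / L)| / L := by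
        rw [abs_neg, abs_mul, abs_div, abs_neg, abs_inv, abs_of_pos h1t, abs_of_pos hLpos]
        field_simp
      rw [hrew]
      exact le_trans (div_le_div_of_nonneg_right hz hLpos.le) hCL
  refine ⟨β, τ₁, hτ₁pos, hτ₁τ₀, hβs, fun t => ?_, hβzero, hβone, hβd⟩
  by_cases h : t < 1 - τ₁ / 2
  · rw [hβφ t h]
    simp only [hφ]
    have := Real.smoothTransition.nonneg (Real.log ((1 - t) / τ₁) / L)
    have := Real.smoothTransition.le_one (Real.log ((1 - t) / τ₁) / L)
    constructor <;> linarith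
  · simp only [hβ, if_neg h]; exact ⟨zero_le_one, le_rfl⟩

end FriendsCarrierVk

open FriendsCarrierVk in
/-- **Helper `helper_friendsCarrier_Vk_partB_logCutoff`** (piece of the registered stub
`helper_friendsCarrier_Vk_partB`: the logarithmic cutoff of the ray reparametrisation).  For `τ₀ > 0`
and `κ > 0` there are `τ₁ ∈ (0, τ₀)` and a `C^∞` function `β : ℝ → [0, 1]` with `β = 0` on
`t ≤ 1 - τ₀`, `β = 1` on `t ≥ 1 - τ₁` and `|β'(t)| (1 - t) ≤ κ` for all `t < 1`. [folklore] -/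
theorem helper_friendsCarrier_Vk_partB_logCutoff : ∀ (τ₀ κ : ℝ), 0 < τ₀ → 0 < κ → ∃ (β : ℝ → ℝ) (τ₁ : ℝ), 0 < τ₁ ∧ τ₁ < τ₀ ∧ ContDiff ℝ ((⊤ : ℕ∞) : WithTop ℕ∞) β ∧ (∀ t, 0 ≤ β t ∧ β t ≤ 1) ∧ (∀ t, t ≤ 1 - τ₀ → β t = 0) ∧ (∀ t, 1 - τ₁ ≤ t → β t = 1) ∧ (∀ t, t < 1 → |deriv β t| * (1 - t) ≤ κ) :=
  fun _ _ hτ₀ hκ => exists_logCutoff hτ₀ hκ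

end Summit.SmoothPoincare4.SmoothPoincare4.Theorems.DcrGap.MkFriends

end
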